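import Summits.BirchSwinnertonDyer.BirchSwinnertonDyer.Theorems.SchneiderFreeAdditiveX3GordTwoBranchIMCNAT
import HarnessLib

/-!
# Route `SchneiderFreeAdditiveX3` (K1 door): crux r3 `GordTwoBranchIMC` (item 19177) SPLITS along Keller–Yin's Assumption 2.0.3 —
# its body OFF the `d_K = −3` sliver holds BY NAME on 13 named statements (10 refereed + 3 preprint clauses: NO `KYReadSliver`,
# NO Cai–Shu–Tian 1.1, NO Gross–Zagier binder), and r3 = (off-sliver body) ∧ (sliver body)

Cell `bsd-schneider-ideate`, seat `bsd-schneider-door-c5` (prover, generation 45; assembly layer; `--supports stmt-BirchSwinnertonDyer-19177`).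
PARTITION: board row B6 ∩ X3 ∩ sst-twist, `r = 1`, the (G-ord, `e = 2`) half (2 560 of 7 101 census pairs; class-wide at every odd `p`) of
`Rank1Residual.partition`; types-the-object-of nothing new; «closes rung: none».

WHY.  Crux r3 as typed (`Theses.SchneiderFreeAdditiveX3.GordTwoBranchIMC` = `AdditiveIMCLowerBDPInputManinAt` on `SubGordTwo`) quantifies over EVERY Heegner
datum of the curve — including the Heegner fields with `d_K = −3`, which lie OUTSIDE Keller–Yin's standing Assumption 2.0.3 ("`D_K < −3`") and are the ONLY
reason the unprinted research statement `KYRead.KYReadSliver` (and, with it, Cai–Shu–Tian Thm. 1.1 and a Gross–Zagier binder) enters r3 BY NAME (generation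
43 `KYBranchNAT.gordTwoBranchIMC_of_anacong_of_sliver`: 15 named + sliver).  This file records, on the current (NAT, Greenberg-free) ledger:
* §1 `additiveIMCLowerBDPOnTree_gordTwo_offSliver` — **r3's body with the one extra antecedent `NumberField.discr K ≠ -3`, at EVERY odd prime and every
  Heegner datum, ⟸ 13 named statements**: {Kolyvagin, Par, Hsieh A, Liu–Zhang–Zhang, Castella–Hsieh signed, CGLS 2022 Thm. 2.1.2 and Prop. 1.2.5 (module
  clause), Bleher et al. 2020 Thm. 3.3.1, de Shalit II.6.4, Hida 2010 Thm. I} ∪ {[DIV.dvd], [AN3], [AN-BR₅]} — `p = 3`: generation 43's class-wide currency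
  `KYBranchNAT.additiveIMCLowerBDPInputManinAt_gordTwo_three` (the sliver is void there, `3 ∣ #𝓞_K^× = 6`); `p ≥ 5`: generation 43's per-datum off-sliver socket
  `NATGordCellFiveLe.additiveIMCLowerBDPOnTree_subGordTwo_five_le_offSliver`.
* §2 `gordTwoBranchIMC_of_offSliver_of_onSliver` / `offSliver_of_gordTwoBranchIMC` / `onSliver_of_gordTwoBranchIMC` — **r3 = (off-sliver body) ∧ (sliver body)**,
  pure logic; so r3 BY NAME = §1 + the sliver body, and the sliver body is where `KYReadSliver` lives.
FOR THE PLANNER (0 ask, analysis): a restatement r3′ := §1's statement (Assumption 2.0.3 made explicit) loses nothing for the rung — the leaf and Miller's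
`BSD(E, p)` on the whole cell are already BY NAME without the sliver (`RungEndStateNoSliver`, p770403) — and r3′ is BY NAME on 13 named statements today.

HONEST FRAMING: compositions of tree theorems, CONDITIONAL BY NAME on every displayed statement (preprint clauses claim-tagged); no definition, no named fact,
no `sorry`; crux r3 stays OPEN; this is NOT a proof of BSD for any curve; «closes rung: none».  References: [KellerYin2024b] Assumption 2.0.3 (arXiv:2410.23241
p. 8), Thm. 3.3.6, §3.4–3.5, Thm. 3.5.1; [CastellaGrossiLeeSkinner2022] Thm. 2.1.2, Prop. 1.2.5; [BleherEtAl2020] Thm. 3.3.1; [deShalit1987] II.6.4;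
[Hida2010MuInvariant] Thm. I; [Hsieh2014] Thm. A; [LiuZhangZhang2018] Thms. 1.5.1/1.5.3; [CastellaHsieh2018] §3.3; [JetchevSkinnerWan2017] §7.4.1; this seat
gen 8 (`LeafOffSliver`), 43, 45.
-/

set_option autoImplicit false
set_option linter.dupNamespace false -- the summit namespace `…BirchSwinnertonDyer.BirchSwinnertonDyer.Theorems` (Sub = Summit, D-0017) trips it

noncomputable section

open scoped Classical NumberField

open Field NumberField IsDedekindDomain WeierstrassCurve PowerSeries
  Literature.NumberTheory.EllipticCurves Literature.NumberTheory.EllipticCurves.GreenbergSelmer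
  Literature.NumberTheory.GaloisRepresentations Literature.NumberTheory.GaloisCohomology
  Literature.NumberTheory.EllipticCurves.ModularForms Literature.NumberTheory.EllipticCurves.Rank1Residual
  Literature.NumberTheory.EllipticCurves.Rank1Residual.Typed
  Literature.NumberTheory.EllipticCurves.KellerYin2024 Literature.NumberTheory.EllipticCurves.CaiShuTian2014
  Literature.NumberTheory.EllipticCurves.Rubin1991 Literature.NumberTheory.EllipticCurves.DeShalit1987
  Literature.NumberTheory.EllipticCurves.Hida2010MuInvariant Literature.NumberTheory.EllipticCurves.BCGKPST2020
  Summit.BirchSwinnertonDyer.Rank1Residual Summit.BirchSwinnertonDyer.Rank1Residual.X11b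
  Summit.BirchSwinnertonDyer.Rank1Residual.Additive Summit.BirchSwinnertonDyer.Rank1Residual.GaloisImage
  Summit.BirchSwinnertonDyer.BirchSwinnertonDyer.Theorems
  Summit.BirchSwinnertonDyer.BirchSwinnertonDyer.Theorems.SchneiderFree
  Summit.BirchSwinnertonDyer.BirchSwinnertonDyer.Theorems.SchneiderFree.KYRead
  Summit.BirchSwinnertonDyer.BirchSwinnertonDyer.Theses.SchneiderFreeAdditiveX3
  Summit.BirchSwinnertonDyer.BirchSwinnertonDyer.Theorems.SchneiderFreeAdditiveX3
open Literature.NumberTheory.EllipticCurves.CastellaGrossiLeeSkinner2022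
  (thm212_exists_isKatzLFunction prop125_characterGrSelmerDual_torsion_muZero_dim)
open Literature.NumberTheory.EllipticCurves.KellerYin2024 (thm351_anacong_branch_three_allTwists thm351_anacong_charLambda_branch_five_le)

namespace Summit.BirchSwinnertonDyer.BirchSwinnertonDyer.Theorems.SchneiderFreeAdditiveX3.KYBranchOffSliver

/-! ### §1 Crux r3's body OFF the `d_K = −3` sliver, every odd prime, on 13 named statements -/

/-- **Crux r3's body OFF the `d_K = −3` sliver (Keller–Yin's Assumption 2.0.3 made explicit), at EVERY odd prime, for every curve of the (G-ord, `e = 2`) cell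
and every Heegner / parametrisation datum with `d_K ≠ −3`: `AdditiveIMCLowerBDPOnTreeLeAt` (T-B6-1♯, Manin-robust) ⟸ 13 named statements** — Kolyvagin, Par
(`nonempty_modularParametrizationData`), Hsieh 2014 Thm. A, Liu–Zhang–Zhang 2018, Castella–Hsieh 2018 signed, [DIV.dvd], [AN3], CGLS 2022 Thm. 2.1.2, [AN-BR₅], CGLS
Prop. 1.2.5 (module clause), Bleher et al. 2020 Thm. 3.3.1, de Shalit II.6.4, Hida 2010 Thm. I — **NO `KYReadSliver`, NO Cai–Shu–Tian 1.1, NO Gross–Zagier binder**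
(r3 BY NAME, generation 43: these 13 + GZ + CST 1.1 + the sliver).  `p = 3`: `KYBranchNAT.additiveIMCLowerBDPInputManinAt_gordTwo_three` (every datum; the sliver is
void at `3`); `p ≥ 5`: `NATGordCellFiveLe.additiveIMCLowerBDPOnTree_subGordTwo_five_le_offSliver`.  CONDITIONAL on every displayed statement; crux r3 stays OPEN;
BSD proved for no curve. [claim: KellerYin2024PotOrd, status: under-review]
[cite: KellerYin2024b, Assumption 2.0.3 (p. 8), Thm. 3.3.6, Prop. 3.4.4, §3.5, Thm. 3.5.1 (arXiv:2410.23241) (preprint; hypotheses)]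
[cite: CastellaGrossiLeeSkinner2022, Thm. 2.1.2, Prop. 1.2.5] [cite: BleherEtAl2020, §3.3 Thm. 3.3.1] [cite: deShalit1987, II.6.4] [cite: Hida2010MuInvariant, Thm. I]
[cite: Hsieh2014, Thm. A p. 712] [cite: LiuZhangZhang2018, Thm 1.5.1 and Thm 1.5.3] [cite: CastellaHsieh2018, §3.3, Def. 3.7, Prop. 3.8]
[cite: JetchevSkinnerWan2017, §7.4.1 (arXiv:1512.06894 p. 30)] -/
theorem additiveIMCLowerBDPOnTree_gordTwo_offSliver
    (hKo : ∀ (N : ℕ) [NeZero N] (W : WeierstrassCurve ℚ) (K : Type) [Field K] [NumberField K],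
      Literature.NumberTheory.EllipticCurves.kolyvagin N W K)
    (hPar : nonempty_modularParametrizationData)
    (hA : Hsieh2014.thmA_exists_isHsiehLFunction_unrPeriod_anyLevel)
    (hL : LiuZhangZhang2018.thm151_thm153_modularCurve_heegnerVector_additive)
    (hCHσ : castellaHsieh2018_exists_isBranchBDPLFunction_signed)
    (hDVD : thm336_dvd_branch_OPEN)
    (hAN3 : thm351_anacong_branch_three_allTwists) (h212 : thm212_exists_isKatzLFunction)
    (hAN5 : thm351_anacong_charLambda_branch_five_le)
    (hprop125 : prop125_characterGrSelmerDual_torsion_muZero_dim)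
    (h331 : thm331_rubin_exists_katzMeasure₂_pseudoIso_span_eq)
    (hFE : thmII64_katzMeasure₂_functionalEquation) (hO1 : thmI_mu_katzBranch_reflect_eq_zero) :
    ∀ (W : WeierstrassCurve ℚ) [W.IsElliptic] [W.IsGloballyMinimal] (p : ℕ) [Fact p.Prime],
      W.analyticRank = 1 → p ≠ 2 → ClassX3 W p → Additive.SubGordTwo W p →
      ∀ (N : ℕ) [NeZero N] (K : Type) [Field K] [NumberField K]
        (Dt : ModularParametrizationData W N) (H : HeegnerDatum N (NumberField.discr K)) (ι : K →+* ℂ)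
        (P : (W.baseChange K).toAffine.Point),
        W.analyticRank = 1 → Additive.N10.Locus W p → W.conductorNorm ℤ = N → IsImaginaryQuadratic K →
        Odd (NumberField.discr K) → ¬ p ∣ Units.torsionOrder K → SatisfiesHeegnerHypothesis N K →
        (W.quadraticTwist (NumberField.discr K : ℚ)).entireLFunction 1 ≠ 0 →
        WeierstrassCurve.Affine.Point.map ι.toRatAlgHom P = heegnerPointComplex Dt H →
        ¬ IsOfFinAddOrder P → NumberField.discr K ≠ -3 →
        ∀ (κ : ZpExtension K p), κ.IsAnticyclotomic →
          ∀ (γ : Field.absoluteGaloisGroup K) [Fact (κ.IsTopGenerator γ)]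
            (𝔭 : HeightOneSpectrum (𝓞 K)) (h𝔭 : ((p : ℕ) : 𝓞 K) ∈ 𝔭.asIdeal)
            (he : 𝔭.asIdeal.ramificationIdx (𝓞 ℚ) = 1) (hf : 𝔭.asIdeal.inertiaDeg (𝓞 ℚ) = 1),
            AdditiveIMCLowerBDPOnTreeLeAt p κ 𝔭 γ (embAt K p 𝔭 h𝔭 he hf) (padicValNat p Dt.c.natAbs) P := by
  intro W _ _ p _ hr hp2 hX hG N _ K _ _ Dt H ι P hr' hloc hN hK hodd hunit hHe hL1 hP hnt hdK κ hκ γ _ 𝔭 h𝔭 he hf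
  have hp : p.Prime := Fact.out
  obtain rfl | hp5 : p = 3 ∨ 5 ≤ p := by
    rcases Nat.lt_or_ge p 5 with h | h
    · left
      have h2 := hp.two_le
      interval_cases p
      · exact absurd rfl hp2
      · rfl
      · exact absurd hp (by norm_num)
    · exact Or.inr h
  · -- `p = 3`: the class-wide currency (every Heegner datum; the sliver is void at `3`)
    exact KYBranchNAT.additiveIMCLowerBDPInputManinAt_gordTwo_three hKo hPar hA hL hCHσ hDVD hAN3.to_branch_three hAN3 h212 h331 hFE hO1
      W hr hX hG N K Dt H ι P hr' hloc hN hK hodd hunit hHe hL1 hP hnt κ hκ γ 𝔭 h𝔭 he hf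
  · -- `p ≥ 5`: the per-datum socket off the sliver
    exact NATGordCellFiveLe.additiveIMCLowerBDPOnTree_subGordTwo_five_le_offSliver hKo hPar hA hL hCHσ hDVD hAN5 hprop125 hp5
      W hr hX hG N K Dt H ι P hr' hloc hN hK hodd hunit hHe hL1 hP hnt hdK κ hκ γ 𝔭 h𝔭 he hf

/-! ### §2 r3 = (off-sliver body) ∧ (sliver body) — pure logic -/

/-- **Crux r3 BY NAME from its two halves along Assumption 2.0.3**: the off-sliver body (§1's statement) and the sliver body (the same with
`NumberField.discr K = -3`) give `Theses.SchneiderFreeAdditiveX3.GordTwoBranchIMC`.  Pure logic (`by_cases` on `d_K = −3`); nothing asserted.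
[cite: KellerYin2024b, Assumption 2.0.3 (arXiv:2410.23241 p. 8) (shape only)] -/
theorem gordTwoBranchIMC_of_offSliver_of_onSliver
    (hoff : ∀ (W : WeierstrassCurve ℚ) [W.IsElliptic] [W.IsGloballyMinimal] (p : ℕ) [Fact p.Prime],
      W.analyticRank = 1 → p ≠ 2 → ClassX3 W p → Additive.SubGordTwo W p →
      ∀ (N : ℕ) [NeZero N] (K : Type) [Field K] [NumberField K]
        (Dt : ModularParametrizationData W N) (H : HeegnerDatum N (NumberField.discr K)) (ι : K →+* ℂ)
        (P : (W.baseChange K).toAffine.Point),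
        W.analyticRank = 1 → Additive.N10.Locus W p → W.conductorNorm ℤ = N → IsImaginaryQuadratic K →
        Odd (NumberField.discr K) → ¬ p ∣ Units.torsionOrder K → SatisfiesHeegnerHypothesis N K →
        (W.quadraticTwist (NumberField.discr K : ℚ)).entireLFunction 1 ≠ 0 →
        WeierstrassCurve.Affine.Point.map ι.toRatAlgHom P = heegnerPointComplex Dt H →
        ¬ IsOfFinAddOrder P → NumberField.discr K ≠ -3 →
        ∀ (κ : ZpExtension K p), κ.IsAnticyclotomic →
          ∀ (γ : Field.absoluteGaloisGroup K) [Fact (κ.IsTopGenerator γ)]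
            (𝔭 : HeightOneSpectrum (𝓞 K)) (h𝔭 : ((p : ℕ) : 𝓞 K) ∈ 𝔭.asIdeal)
            (he : 𝔭.asIdeal.ramificationIdx (𝓞 ℚ) = 1) (hf : 𝔭.asIdeal.inertiaDeg (𝓞 ℚ) = 1),
            AdditiveIMCLowerBDPOnTreeLeAt p κ 𝔭 γ (embAt K p 𝔭 h𝔭 he hf) (padicValNat p Dt.c.natAbs) P)
    (hon : ∀ (W : WeierstrassCurve ℚ) [W.IsElliptic] [W.IsGloballyMinimal] (p : ℕ) [Fact p.Prime],
      W.analyticRank = 1 → p ≠ 2 → ClassX3 W p → Additive.SubGordTwo W p →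
      ∀ (N : ℕ) [NeZero N] (K : Type) [Field K] [NumberField K]
        (Dt : ModularParametrizationData W N) (H : HeegnerDatum N (NumberField.discr K)) (ι : K →+* ℂ)
        (P : (W.baseChange K).toAffine.Point),
        W.analyticRank = 1 → Additive.N10.Locus W p → W.conductorNorm ℤ = N → IsImaginaryQuadratic K →
        Odd (NumberField.discr K) → ¬ p ∣ Units.torsionOrder K → SatisfiesHeegnerHypothesis N K →
        (W.quadraticTwist (NumberField.discr K : ℚ)).entireLFunction 1 ≠ 0 →
        WeierstrassCurve.Affine.Point.map ι.toRatAlgHom P = heegnerPointComplex Dt H →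
        ¬ IsOfFinAddOrder P → NumberField.discr K = -3 →
        ∀ (κ : ZpExtension K p), κ.IsAnticyclotomic →
          ∀ (γ : Field.absoluteGaloisGroup K) [Fact (κ.IsTopGenerator γ)]
            (𝔭 : HeightOneSpectrum (𝓞 K)) (h𝔭 : ((p : ℕ) : 𝓞 K) ∈ 𝔭.asIdeal)
            (he : 𝔭.asIdeal.ramificationIdx (𝓞 ℚ) = 1) (hf : 𝔭.asIdeal.inertiaDeg (𝓞 ℚ) = 1),
            AdditiveIMCLowerBDPOnTreeLeAt p κ 𝔭 γ (embAt K p 𝔭 h𝔭 he hf) (padicValNat p Dt.c.natAbs) P) :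
    Summit.BirchSwinnertonDyer.BirchSwinnertonDyer.Theses.SchneiderFreeAdditiveX3.GordTwoBranchIMC := by
  intro W _ _ p _ hr hp2 hX hG N _ K _ _ Dt H ι P hr' hloc hN hK hodd hunit hHe hL1 hP hnt κ hκ γ _ 𝔭 h𝔭 he hf
  by_cases hdK : NumberField.discr K = -3
  · exact hon W p hr hp2 hX hG N K Dt H ι P hr' hloc hN hK hodd hunit hHe hL1 hP hnt hdK κ hκ γ 𝔭 h𝔭 he hf
  · exact hoff W p hr hp2 hX hG N K Dt H ι P hr' hloc hN hK hodd hunit hHe hL1 hP hnt hdK κ hκ γ 𝔭 h𝔭 he hf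

/-- Conversely (trivial projection): crux r3 BY NAME gives its off-sliver body. [cite: KellerYin2024b, Assumption 2.0.3 (arXiv:2410.23241 p. 8) (shape only)] -/
theorem offSliver_of_gordTwoBranchIMC
    (h3 : Summit.BirchSwinnertonDyer.BirchSwinnertonDyer.Theses.SchneiderFreeAdditiveX3.GordTwoBranchIMC) :
    ∀ (W : WeierstrassCurve ℚ) [W.IsElliptic] [W.IsGloballyMinimal] (p : ℕ) [Fact p.Prime],
      W.analyticRank = 1 → p ≠ 2 → ClassX3 W p → Additive.SubGordTwo W p →
      ∀ (N : ℕ) [NeZero N] (K : Type) [Field K] [NumberField K]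
        (Dt : ModularParametrizationData W N) (H : HeegnerDatum N (NumberField.discr K)) (ι : K →+* ℂ)
        (P : (W.baseChange K).toAffine.Point),
        W.analyticRank = 1 → Additive.N10.Locus W p → W.conductorNorm ℤ = N → IsImaginaryQuadratic K →
        Odd (NumberField.discr K) → ¬ p ∣ Units.torsionOrder K → SatisfiesHeegnerHypothesis N K →
        (W.quadraticTwist (NumberField.discr K : ℚ)).entireLFunction 1 ≠ 0 →
        WeierstrassCurve.Affine.Point.map ι.toRatAlgHom P = heegnerPointComplex Dt H →
        ¬ IsOfFinAddOrder P → NumberField.discr K ≠ -3 →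
        ∀ (κ : ZpExtension K p), κ.IsAnticyclotomic →
          ∀ (γ : Field.absoluteGaloisGroup K) [Fact (κ.IsTopGenerator γ)]
            (𝔭 : HeightOneSpectrum (𝓞 K)) (h𝔭 : ((p : ℕ) : 𝓞 K) ∈ 𝔭.asIdeal)
            (he : 𝔭.asIdeal.ramificationIdx (𝓞 ℚ) = 1) (hf : 𝔭.asIdeal.inertiaDeg (𝓞 ℚ) = 1),
            AdditiveIMCLowerBDPOnTreeLeAt p κ 𝔭 γ (embAt K p 𝔭 h𝔭 he hf) (padicValNat p Dt.c.natAbs) P :=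
  fun W _ _ p _ hr hp2 hX hG N _ K _ _ Dt H ι P hr' hloc hN hK hodd hunit hHe hL1 hP hnt _ κ hκ γ _ 𝔭 h𝔭 he hf ↦
    h3 W p hr hp2 hX hG N K Dt H ι P hr' hloc hN hK hodd hunit hHe hL1 hP hnt κ hκ γ 𝔭 h𝔭 he hf

/-- **What crux r3 BY NAME needs BEYOND §1 is exactly its `d_K = −3` sliver body** — the contrapositive bookkeeping of the split: given §1's thirteen
statements, r3 BY NAME ⟸ the sliver body alone.  CONDITIONAL; crux r3 stays OPEN; BSD proved for no curve. [claim: KellerYin2024PotOrd, status: under-review]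
[cite: KellerYin2024b, Assumption 2.0.3 (p. 8), Thm. 3.5.1 (arXiv:2410.23241) (preprint; hypotheses)] [cite: CastellaGrossiLeeSkinner2022, Thm. 2.1.2, Prop. 1.2.5] -/
theorem gordTwoBranchIMC_of_reads_of_onSliver
    (hKo : ∀ (N : ℕ) [NeZero N] (W : WeierstrassCurve ℚ) (K : Type) [Field K] [NumberField K],
      Literature.NumberTheory.EllipticCurves.kolyvagin N W K)
    (hPar : nonempty_modularParametrizationData)
    (hA : Hsieh2014.thmA_exists_isHsiehLFunction_unrPeriod_anyLevel)
    (hL : LiuZhangZhang2018.thm151_thm153_modularCurve_heegnerVector_additive)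
    (hCHσ : castellaHsieh2018_exists_isBranchBDPLFunction_signed)
    (hDVD : thm336_dvd_branch_OPEN)
    (hAN3 : thm351_anacong_branch_three_allTwists) (h212 : thm212_exists_isKatzLFunction)
    (hAN5 : thm351_anacong_charLambda_branch_five_le)
    (hprop125 : prop125_characterGrSelmerDual_torsion_muZero_dim)
    (h331 : thm331_rubin_exists_katzMeasure₂_pseudoIso_span_eq)
    (hFE : thmII64_katzMeasure₂_functionalEquation) (hO1 : thmI_mu_katzBranch_reflect_eq_zero)
    (hon : ∀ (W : WeierstrassCurve ℚ) [W.IsElliptic] [W.IsGloballyMinimal] (p : ℕ) [Fact p.Prime],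
      W.analyticRank = 1 → p ≠ 2 → ClassX3 W p → Additive.SubGordTwo W p →
      ∀ (N : ℕ) [NeZero N] (K : Type) [Field K] [NumberField K]
        (Dt : ModularParametrizationData W N) (H : HeegnerDatum N (NumberField.discr K)) (ι : K →+* ℂ)
        (P : (W.baseChange K).toAffine.Point),
        W.analyticRank = 1 → Additive.N10.Locus W p → W.conductorNorm ℤ = N → IsImaginaryQuadratic K →
        Odd (NumberField.discr K) → ¬ p ∣ Units.torsionOrder K → SatisfiesHeegnerHypothesis N K →
        (W.quadraticTwist (NumberField.discr K : ℚ)).entireLFunction 1 ≠ 0 →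
        WeierstrassCurve.Affine.Point.map ι.toRatAlgHom P = heegnerPointComplex Dt H →
        ¬ IsOfFinAddOrder P → NumberField.discr K = -3 →
        ∀ (κ : ZpExtension K p), κ.IsAnticyclotomic →
          ∀ (γ : Field.absoluteGaloisGroup K) [Fact (κ.IsTopGenerator γ)]
            (𝔭 : HeightOneSpectrum (𝓞 K)) (h𝔭 : ((p : ℕ) : 𝓞 K) ∈ 𝔭.asIdeal)
            (he : 𝔭.asIdeal.ramificationIdx (𝓞 ℚ) = 1) (hf : 𝔭.asIdeal.inertiaDeg (𝓞 ℚ) = 1),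
            AdditiveIMCLowerBDPOnTreeLeAt p κ 𝔭 γ (embAt K p 𝔭 h𝔭 he hf) (padicValNat p Dt.c.natAbs) P) :
    Summit.BirchSwinnertonDyer.BirchSwinnertonDyer.Theses.SchneiderFreeAdditiveX3.GordTwoBranchIMC :=
  gordTwoBranchIMC_of_offSliver_of_onSliver
    (additiveIMCLowerBDPOnTree_gordTwo_offSliver hKo hPar hA hL hCHσ hDVD hAN3 h212 hAN5 hprop125 h331 hFE hO1) hon

end Summit.BirchSwinnertonDyer.BirchSwinnertonDyer.Theorems.SchneiderFreeAdditiveX3.KYBranchOffSliver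

end
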